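import Summits.ValiantsHypothesis.ValiantsHypothesis.Theses.BorderApolarity
import Summits.ValiantsHypothesis.ValiantsHypothesis.Theses.GCTMult
import Literature.Computability.AlgebraicComplexity.BorderApolarityMembership
import Literature.Computability.AlgebraicComplexity.BorderDcQuadraticBoundProofs

/-!
# The crux `FixedWitnessObstructionQP` follows from the quasi-polynomial Mulmuley–Sohoni thesis
# (stmt-ValiantsHypothesis-5778, route `BorderApolarity`; kernel-checked sandwich)

* `witnessToMembership_holds` — the route's support decl `WitnessToMembership` (stmt-5782), by
  `Literature.Computability.AlgebraicComplexity.BorderApolarity.mem_orbitClosure_of_witness`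
  (`Literature/…/BorderApolarityMembership.lean`): a border-apolar witness over `X₀₀^{m−n} per_n`
  forces `X₀₀^{m−n} per_n ∈ Δ(det_m)`.
* `FixedWitnessObstructionQP_of_gctThesis` — **`GCTMult.GctThesis → FixedWitnessObstructionQP`**,
  unconditionally: the crux is implied by the quasi-polynomial Mulmuley–Sohoni thesis (crux
  stmt-0323 of route `GCTMult`, verbatim the hypothesis of this route's `GctBridge`).
* `FixedWitnessObstructionQP_iff_gctThesis` — given the route's other support decl
  `BorelFixedBorderApolarity` (stmt-5781, Borel fixed point theorem on the border-apolarity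
  variety; not proved here), the crux is EQUIVALENT to `GCTMult.GctThesis`.
* `gctThesis_slice_one` — the `c = 1` slice of the thesis (window `m ≤ 2^(log₂ n + 1) ≤ 2n`) is an
  unconditional theorem by LMR13 `n² ≤ 2m` (`LMR2013_thm_1_1_1_holds`), hence so is the `c = 1`
  slice of the crux (`FixedWitnessObstructionQP_slice_one`); the `c = 0` window is empty.

So the content of the crux starts at `c = 2`, where it is exactly the open thesis: this file is the
lead prover's census of WHY the line `cone-purity-squeeze` (whose five infrastructure stubs are
landed as `…QP{ConePurity,H0Elementary,AnnSubmodule,KuratowskiSubmodule,LimitIdeal}.lean`) stops at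
its sixth stub, the climb.  Mirrors §1/§7/§8 of the crux disprover's `Cruxes/…/Disproof.lean`.
-/

namespace Summit.ValiantsHypothesis.ValiantsHypothesis.Theorems.BorderApolarityFixedWitnessObstructionQP

open Literature.Computability.AlgebraicComplexity
open Summit.ValiantsHypothesis.ValiantsHypothesis.Theses
open Summit.ValiantsHypothesis.ValiantsHypothesis.Theses.BorderApolarity

/-- **`WitnessToMembership` (support item stmt-ValiantsHypothesis-5782 of route `BorderApolarity`)
holds**: for `3 ≤ n ≤ m`, a Borel-fixed border-apolar witness `(P, J)` over `X₀₀^{m−n} per_n`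
forces `X₀₀^{m−n} per_n ∈ Δ(det_m)` (only W1, W3 and W5 in degree `m` are used). [folklore] -/
theorem witnessToMembership_holds : WitnessToMembership := by
  intro n m _ _ hnm act rk
  rintro ⟨P, J, h1, -, h3, -, h5⟩
  exact Literature.Computability.AlgebraicComplexity.BorderApolarity.mem_orbitClosure_of_witness hnm P J h1 h3 h5

/-- **The crux follows from the quasi-polynomial Mulmuley–Sohoni thesis**:
`GCTMult.GctThesis → BorderApolarity.FixedWitnessObstructionQP`, unconditionally (a witness in the
window would put the padded permanent into `Δ(det_m)`). [folklore] -/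
theorem FixedWitnessObstructionQP_of_gctThesis (hG : GCTMult.GctThesis) :
    FixedWitnessObstructionQP := by
  intro c
  obtain ⟨n₀, hn₀⟩ := hG c
  refine ⟨n₀, fun n hn m _ hnm hm => ?_⟩
  intro act rk
  rintro ⟨P, J, h1, -, h3, -, h5⟩
  exact hn₀ n hn m hnm hm
    (Literature.Computability.AlgebraicComplexity.BorderApolarity.mem_orbitClosure_of_witness hnm P J h1 h3 h5)

/-- Conversely, given the support decl `BorelFixedBorderApolarity` (membership forces a fixed
witness for `3 ≤ n ≤ m`), the crux implies the thesis. [folklore] -/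
theorem gctThesis_of_FixedWitnessObstructionQP (hB : BorelFixedBorderApolarity)
    (hX : FixedWitnessObstructionQP) : GCTMult.GctThesis := by
  intro c
  obtain ⟨n₀, hn₀⟩ := hX c
  refine ⟨max n₀ 3, fun n hn m _ hnm hm hmem => ?_⟩
  have h3 : 3 ≤ n := le_trans (le_max_right _ _) hn
  exact hn₀ n (le_trans (le_max_left _ _) hn) m hnm hm (hB n m h3 hnm hmem)

/-- **Sandwich**: given `BorelFixedBorderApolarity`, the crux `FixedWitnessObstructionQP` is
EQUIVALENT to `GCTMult.GctThesis` (the quasi-polynomial Mulmuley–Sohoni thesis). [folklore] -/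
theorem FixedWitnessObstructionQP_iff_gctThesis (hB : BorelFixedBorderApolarity) :
    FixedWitnessObstructionQP ↔ GCTMult.GctThesis :=
  ⟨gctThesis_of_FixedWitnessObstructionQP hB, FixedWitnessObstructionQP_of_gctThesis⟩

/-- The `c = 1` slice of the thesis is a theorem: for `n ≥ 5` and `n ≤ m ≤ 2^(log₂ n + 1)` the
padded permanent is not in `Δ(det_m)`, by LMR13 `n² ≤ 2m` (`LMR2013_thm_1_1_1_holds`).
[cite: LandsbergManivelRessayre2013, Theorem 1.1.1] -/
theorem gctThesis_slice_one :
    ∃ n₀ : ℕ, ∀ n ≥ n₀, ∀ (m : ℕ) [NeZero m], n ≤ m → m ≤ 2 ^ ((Nat.log 2 n + 1) ^ 1) →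
      paddedPerPoly ℂ n m ∉ orbitClosure (detPoly (Fin m) ℂ) := by
  refine ⟨5, fun n hn m _ hnm hm hmem => ?_⟩
  have hlmr : n ^ 2 ≤ 2 * m := LMR2013_thm_1_1_1_holds n m hnm hmem
  have hlog : 2 ^ Nat.log 2 n ≤ n := Nat.pow_log_le_self 2 (by omega)
  have hpow : 2 ^ ((Nat.log 2 n + 1) ^ 1) = 2 ^ Nat.log 2 n * 2 := by
    rw [pow_one, pow_succ]
  have hm' : m ≤ 2 * n := by
    rw [hpow] at hm
    omega
  nlinarith

/-- Hence the `c = 1` slice of the crux is a theorem as well (threshold `n₀ = 5`): for `n ≥ 5` and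
`n ≤ m ≤ 2^(log₂ n + 1)` there is no pair `(P, J)` with `P_t ∈ GL·det_m` (W1), the limsup clause
(W3) and apolarity to `X₀₀^{m−n} per_n` (W5) — a fortiori no witness of the crux.
[cite: LandsbergManivelRessayre2013, Theorem 1.1.1] -/
theorem FixedWitnessObstructionQP_slice_one :
    ∃ n₀ : ℕ, ∀ n ≥ n₀, ∀ (m : ℕ) [NeZero m], n ≤ m → m ≤ 2 ^ ((Nat.log 2 n + 1) ^ 1) →
      ∀ (P : ℕ → MvPolynomial (Fin m × Fin m) ℂ) (J : ℕ → Set (MvPolynomial (Fin m × Fin m) ℂ)),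
        (∀ t, P t ∈ glOrbit (Fin m × Fin m) ℂ (detPoly (Fin m) ℂ)) →
        (∀ k ≤ m, ∀ (D : MvPolynomial (Fin m × Fin m) ℂ) (φ : ℕ → ℕ)
          (Ds : ℕ → MvPolynomial (Fin m × Fin m) ℂ), StrictMono φ →
          (∀ t, (Ds t).IsHomogeneous k ∧ apolarAction (Ds t) (P (φ t)) = 0) →
          Filter.Tendsto (fun t => coeffVec (Ds t)) Filter.atTop (nhds (coeffVec D)) → D ∈ J k) →
        (∀ k ≤ m, ∀ D ∈ J k, apolarAction D (paddedPerPoly ℂ n m) = 0) → False := by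
  obtain ⟨n₀, hn₀⟩ := gctThesis_slice_one
  exact ⟨n₀, fun n hn m _ hnm hm P J h1 h3 h5 =>
    hn₀ n hn m hnm hm
      (Literature.Computability.AlgebraicComplexity.BorderApolarity.mem_orbitClosure_of_witness hnm P J h1 h3 h5)⟩

/-- The `c = 0` window `n ≤ m ≤ 2^((log₂ n)^0) = 2` is empty for `n ≥ 3`. [folklore] -/
theorem window_zero_empty {n m : ℕ} (hn : 3 ≤ n) (hnm : n ≤ m)
    (hm : m ≤ 2 ^ ((Nat.log 2 n + 0) ^ 0)) : False := by
  simp only [pow_zero, pow_one] at hm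
  omega

end Summit.ValiantsHypothesis.ValiantsHypothesis.Theorems.BorderApolarityFixedWitnessObstructionQP
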